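import Summits.ResolutionOfSingularities.ResolutionOfSingularities.Theorems.UniversalCellsCampaignW82TwistFiniteModel
import Summits.ResolutionOfSingularities.ResolutionOfSingularities.Theorems.UniversalCellsCampaignW82FiniteTwistCurves
import HarnessLib

/-!
# [OURS · L1 W8.2] LINKS BY NAME: the finite-modification step (draft (C), p521591) HOLDS at every grade `n ≤ 1`
# — res-L1-s82-pv-1's curve theorems (p519833) read against `CampaignW82.FrobeniusTwistStepFinite(Regular)At` / `HasSmoothFiniteTwistModel`

Cell `res-hironaka` (run/shared/lean/pub/res-hironaka/), LADDER-RESOLUTION rung L (RESCUE), slot W8.2 of plan/RESCUE-SEED.md; host route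
`UniversalCells`, host item `PrimeFieldToPerfect` (stmt-ResolutionOfSingularities-15233). Links file (Theses-free, def-free), written by
res-L1-type-o6 (OURS typer o6, g25) on its own validated one-liners (probe of 2026-08-27T10:24:56Z; offered to res-L1-s82-pv-1 twice).

WHAT. `…W82TwistFiniteModel.lean` (o6, p521591) typed the OURS Props `FrobeniusTwistStepFiniteAt p M n`,
`FrobeniusTwistStepFiniteRegularAt p M n`, `HasSmoothFiniteTwistModel p K f₀` («some FINITE birational modification of some Frobenius
twist is smooth»). res-L1-s82-pv-2 refuted them BY NAME at every grade `2 ≤ n` (`…W82TwistNormalFiniteLinks.lean`, p522686). res-L1-s82-pv-1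
PROVED the bodies at `n ≤ 1` with inline statements (`…W82FiniteTwistCurves.lean`, p519833: a proper birational morphism onto a
Noetherian integral scheme of dimension `≤ 1` is finite, ZMT). This file records the three positive links BY NAME — each is `exact` of
pv-1's theorem (the OURS defs unfold definitionally):
* `frobeniusTwistStepFiniteAt_of_le_one` — `n ≤ 1 → FrobeniusTwistStepFiniteAt p M n`, every prime `p`, every field `M` of char `p`;
* `frobeniusTwistStepFiniteRegularAt_of_le_one` — the regular form;
* `hasSmoothFiniteTwistModel_of_dim_le_one` — pointwise: every separated f.t. `X₀/K` of dimension `≤ 1` with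
  `IntegralOverPerfectClosure K f₀` has a finite smooth twist model.
With p522686 this closes the grading of (C) BY NAME: TRUE for `n ≤ 1`, FALSE (↔ failure of the hypothesis block) for `2 ≤ n`.

HONEST FRAMING. OURS theorems about OURS statements (role replaced: §17 ¶2 p.89 l.59–62 of [Hironaka2017] read with §2 p.4 l.22–24,
typed AS PRINTED as `S17Methodology.U89_3`); NOT statements of the manuscript; nothing attributed to its author; no claim about resolution
of singularities in characteristic `p` beyond curves (where it is classical). AI work, weaker than expert review. [folklore]
-/

noncomputable section

set_option linter.dupNamespace false -- mandated namespace of this single-conjunct summit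

open _root_.CategoryTheory _root_.CategoryTheory.Limits _root_.AlgebraicGeometry

namespace Summit.ResolutionOfSingularities.ResolutionOfSingularities.Theorems.CampaignW82

/-- **(C) at grade `n ≤ 1`: the finite-modification step HOLDS** (every prime `p`, every field `M` of characteristic `p`), BY NAME from
res-L1-s82-pv-1's `finiteTwistStep_of_le_one`. [folklore] -/
theorem frobeniusTwistStepFiniteAt_of_le_one (p : ℕ) [Fact p.Prime] (M : Type) [Field M] [CharP M p]
    {n : WithBot ℕ∞} (hn : n ≤ 1) : FrobeniusTwistStepFiniteAt p M n :=
  finiteTwistStep_of_le_one p M hn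

/-- **(C), regular form, at grade `n ≤ 1`**, BY NAME from `finiteTwistStepRegular_of_le_one`. [folklore] -/
theorem frobeniusTwistStepFiniteRegularAt_of_le_one (p : ℕ) [Fact p.Prime] (M : Type) [Field M] [CharP M p]
    {n : WithBot ℕ∞} (hn : n ≤ 1) : FrobeniusTwistStepFiniteRegularAt p M n :=
  finiteTwistStepRegular_of_le_one p M hn

/-- **Pointwise: curves have finite smooth twist models** — `HasSmoothFiniteTwistModel p K f₀` for every separated `f₀ : X₀ ⟶ Spec K`
of finite type with `dim X₀ ≤ 1` and `IntegralOverPerfectClosure K f₀`, BY NAME from `exists_finite_smooth_model_twist_of_dim_le_one`.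
[folklore] -/
theorem hasSmoothFiniteTwistModel_of_dim_le_one (p : ℕ) [Fact p.Prime] (K : Type) [Field K] [CharP K p]
    {X₀ : Scheme.{0}} (f₀ : X₀ ⟶ Spec (.of K)) [IsSeparated f₀] [LocallyOfFiniteType f₀] [QuasiCompact f₀]
    (hd : topologicalKrullDim X₀ ≤ 1) (hint : IntegralOverPerfectClosure K f₀) :
    HasSmoothFiniteTwistModel p K f₀ :=
  exists_finite_smooth_model_twist_of_dim_le_one p K f₀ hd hint

end Summit.ResolutionOfSingularities.ResolutionOfSingularities.Theorems.CampaignW82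

end
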